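import Summits.KontsevichZagierPeriods.KontsevichZagierPeriods.Theorems.LinRedNormalFormArrangementNormalFormStubRebaseSimpleZeroProductAbove

/-!
# Stub `stub_rebaseSimpleZeroTwo`, part `rebaseSimpleZero_product` (crux `ArrangementNormalForm`, line `janus-bands`) — `Fibre`

Processing ONE fibre `i` of a product representation over a one-dimensional base
(`RebaseZero.IsProd`), the other fibres riding along as spectators, given the continuation
hypothesis `RebaseZero.HP T i U V a` (the `k`-fibre version of `RebaseOne.good_band`):
* `RebaseZero.good_cU` — lettered fibre with `c < Uᵢ` on the base cell: record the row
  `Vᵢ − Uᵢ > 0` (`IsProd.addRow`) and apply part `Above` (`RebaseZero.good_above`);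
* `RebaseZero.good_below` — lettered fibre with `Vᵢ < c`: reflect `tᵢ ↦ −tᵢ` (`RebaseZero.reflect`),
  then `good_cU`;
* `RebaseZero.good_cross` — letter graph strictly between the bounds: cut the fibre along the
  letter (`RebaseZero.fibSplit`); both halves have a bound ON the letter, hence are terminal
  (`RebaseZero.good_terminal`);
* `RebaseZero.good_lettered` — sign dissection of the base cell by the atoms `Uᵢ − c`, `Vᵢ − c`
  (`RebaseZero.rowSplit`, rule 1a) into the cases above / cross / below (or terminal if a bound
  is parallel to the letter);
* `RebaseZero.good_fibre` — letter-free fibres are terminal, lettered ones `good_lettered`.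
Registered: `rebaseSimpleZeroProduct_fibre`.

References: M. Kontsevich, D. Zagier, *Periods* (2001), §1.2.
-/

noncomputable section

open Set MeasureTheory MvPolynomial
open Literature.NumberTheory.Transcendental Literature.ModelTheory.ExponentialFields

namespace Summit.KontsevichZagierPeriods.ArrangementNormalForm.JanusBands

namespace RebaseZero

open SeparatePos RebasePos

variable {k : ℕ}

/-- A lettered fibre with `c < Uᵢ` on the base cell is good: add the redundant row `Vᵢ − Uᵢ > 0`
and apply part `Above`. [folklore] -/
theorem good_cU {s : KZ.IntegralRep (0 + 1 + k)} {m' : ℕ} {M : Fin m' → Cf} {U V : Fin k → Cf}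
    {T : BData} {p : MvPolynomial (Fin 0) ℚ} {a : Fin k → Option Cf} (h : IsProd s M U V T p a)
    (i : Fin k) (c : Cf) (ha : a i = some c) (hP : HP T i U V a)
    (hI : ∀ y ∈ cell M, ev c y < ev (U i) y) : Good k (KZ.of s) :=
  good_above (h.addRow i) i c ha hP fun y hy => by
    rw [mem_cell_snoc, ev_sub, sub_pos] at hy
    exact ⟨hI y hy.1, hy.2⟩

/-- A lettered fibre with `Vᵢ < c` on the base cell is good: reflect `tᵢ ↦ −tᵢ`, then `good_cU`.
[folklore] -/
theorem good_below {s : KZ.IntegralRep (0 + 1 + k)} {m' : ℕ} {M : Fin m' → Cf} {U V : Fin k → Cf}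
    {T : BData} {p : MvPolynomial (Fin 0) ℚ} {a : Fin k → Option Cf} (h : IsProd s M U V T p a)
    (i : Fin k) (c : Cf) (ha : a i = some c) (hP : HP T i U V a)
    (hI : ∀ y ∈ cell M, ev (V i) y < ev c y) : Good k (KZ.of s) := by
  obtain ⟨s', h', hrel⟩ := reflect h i
  refine good_of_sub_mem hrel (good_cU h' i (-c) ?_ (hP.transfer (same_update i U V a _ _ _))
    fun y hy => ?_)
  · rw [Function.update_self, ha, Option.map_some]
  · rw [Function.update_self, ev_neg, ev_neg, neg_lt_neg_iff]
    exact hI y hy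

/-- A lettered fibre CROSSED by its letter (`Uᵢ < c < Vᵢ` on the base cell) is good: cut along
the letter graph (rule 1a); both halves have a bound on the letter and are terminal. [folklore] -/
theorem good_cross {s : KZ.IntegralRep (0 + 1 + k)} {m' : ℕ} {M : Fin m' → Cf} {U V : Fin k → Cf}
    {T : BData} {p : MvPolynomial (Fin 0) ℚ} {a : Fin k → Option Cf} (h : IsProd s M U V T p a)
    (i : Fin k) (c : Cf) (ha : a i = some c) (hP : HP T i U V a)
    (hI : ∀ y ∈ cell M, ev (U i) y < ev c y ∧ ev c y < ev (V i) y) : Good k (KZ.of s) := by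
  have hsome : ∀ c', a i = some c' → c' = c := fun c' hc' => by
    rw [ha] at hc'; exact (Option.some.inj hc').symm
  refine fibSplit h i c (fun y hy => ⟨(hI y hy).1.le, (hI y hy).2.le⟩) (fun s₁ h₁ => ?_)
    (fun s₂ h₂ => ?_)
  · refine good_terminal h₁ i (hP.transfer fun j hj => ⟨rfl, rfl, Function.update_of_ne hj _ _⟩)
      fun c' hc' => Or.inr ?_
    rw [hsome c' hc', Function.update_self]
  · refine good_terminal h₂ i (hP.transfer fun j hj => ⟨rfl, Function.update_of_ne hj _ _, rfl⟩)
      fun c' hc' => Or.inl ?_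
    rw [hsome c' hc', Function.update_self]

/-- An atom whose slope differs from that of `c` is not `c`. [folklore] -/
theorem sub_ne_zero_of_fst_ne {u c : Cf} (h : u.1 (Fin.last 0) ≠ c.1 (Fin.last 0)) : u - c ≠ 0 :=
  fun h0 => h (sub_eq_zero.1 (by rw [← sub_fst, h0]; rfl))

/-- **A lettered fibre is good** (given the continuation hypothesis): a bound parallel to the
letter is terminal; otherwise dissect the base cell by the signs of `Uᵢ − c` and `Vᵢ − c`
(rule 1a, null walls) into the cases `c < Uᵢ` (part `Above`), `Uᵢ < c < Vᵢ` (cross) and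
`Vᵢ < c` (below). [folklore] -/
theorem good_lettered {s : KZ.IntegralRep (0 + 1 + k)} {m' : ℕ} {M : Fin m' → Cf}
    {U V : Fin k → Cf} {T : BData} {p : MvPolynomial (Fin 0) ℚ} {a : Fin k → Option Cf}
    (h : IsProd s M U V T p a) (i : Fin k) (c : Cf) (ha : a i = some c) (hP : HP T i U V a) :
    Good k (KZ.of s) := by
  have hsome : ∀ c', a i = some c' → c' = c := fun c' hc' => by
    rw [ha] at hc'; exact (Option.some.inj hc').symm
  by_cases hU : (U i).1 (Fin.last 0) = c.1 (Fin.last 0)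
  · exact good_terminal h i hP fun c' hc' => Or.inl (by rw [hsome c' hc', hU])
  by_cases hV : (V i).1 (Fin.last 0) = c.1 (Fin.last 0)
  · exact good_terminal h i hP fun c' hc' => Or.inr (by rw [hsome c' hc', hV])
  refine rowSplit h (U i - c) (sub_ne_zero_of_fst_ne hU) (fun s₁ h₁ => ?_) (fun s₁ h₁ => ?_)
  · exact good_cU h₁ i c ha hP fun y hy => by
      have := ((mem_cell_snoc _ _ _).1 hy).2
      rw [ev_sub] at this
      linarith
  · have hUc : ∀ y ∈ cell (Fin.snoc M (-(U i - c)) : Fin (m' + 1) → Cf), ev (U i) y < ev c y :=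
      fun y hy => by
        have := ((mem_cell_snoc _ _ _).1 hy).2
        rw [ev_neg, ev_sub] at this
        linarith
    refine rowSplit h₁ (V i - c) (sub_ne_zero_of_fst_ne hV) (fun s₂ h₂ => ?_) (fun s₂ h₂ => ?_)
    · exact good_cross h₂ i c ha hP fun y hy => by
        obtain ⟨h1, h2⟩ := (mem_cell_snoc _ _ _).1 hy
        rw [ev_sub] at h2
        exact ⟨hUc y h1, by linarith⟩
    · exact good_below h₂ i c ha hP fun y hy => by
        have := ((mem_cell_snoc _ _ _).1 hy).2
        rw [ev_neg, ev_sub] at this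
        linarith

/-- **Every fibre can be processed** (given the continuation hypothesis): a letter-free fibre is
terminal, a lettered one is `good_lettered`. [folklore] -/
theorem good_fibre {s : KZ.IntegralRep (0 + 1 + k)} {m' : ℕ} {M : Fin m' → Cf}
    {U V : Fin k → Cf} {T : BData} {p : MvPolynomial (Fin 0) ℚ} {a : Fin k → Option Cf}
    (h : IsProd s M U V T p a) (i : Fin k) (hP : HP T i U V a) : Good k (KZ.of s) := by
  rcases ha : a i with _ | c
  · exact good_terminal h i hP fun c hc => by rw [ha] at hc; exact absurd hc (Option.some_ne_none c).symm
  · exact good_lettered h i c ha hP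

end RebaseZero

/-- Registered support goal of this file: one fibre of a product representation over a
one-dimensional base can be processed, given the continuation hypothesis (`RebaseZero.good_fibre`). -/
theorem rebaseSimpleZeroProduct_fibre (k m' : ℕ) (s : KZ.IntegralRep (0 + 1 + k)) (M : Fin m' → (Fin (0 + 1) → ℚ) × ℚ) (U V : Fin k → (Fin (0 + 1) → ℚ) × ℚ) (T : RebaseZero.BData) (p : MvPolynomial (Fin 0) ℚ) (a : Fin k → Option ((Fin (0 + 1) → ℚ) × ℚ)) (h : RebaseZero.IsProd s M U V T p a) (i : Fin k) (hP : RebaseZero.HP T i U V a) : RebaseZero.Good k (KZ.of s) :=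
  RebaseZero.good_fibre h i hP

end Summit.KontsevichZagierPeriods.ArrangementNormalForm.JanusBands
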